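import Summits.ResolutionOfSingularities.ResolutionOfSingularities.Theorems.FrobeniusClosingPatchingRelPerfectDepthPhaseCCarrierGameLift
import HarnessLib

/-!
# Crux `PatchingRelPerfect` (stmt-ResolutionOfSingularities-16161), chain W5.2 — F7(β) (β-AX) X3 C-I finish, CE1
# `…DepthPhaseCCarrierGameLift`, part 5 (AMBIENT FRONT-END): the carrier game with LETTERS GIVEN AS AMBIENT DIVISORS

[OURS · L1 W5.2 · CE1 plumbing for res-L1-w52-idea-1 memo-4 §31 («J = monomial sum in 𝓛-letters written X-globally … to avoid
Γ.subscheme plumbing in the interface») after RULING G12-5 / G12-10 → res-D-pv-046; CE1 parts 1–4 = p556330, p556791, p560603, p561817]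
Replaces the role of NO printed item; NOT a statement of the manuscript under review; fact-free; any dimension.

`carrierGameLift` (part 4) takes the letters as ideal sheaves ON THE CARRIER `Γ = V(G)` (duplicate-free, snc) and the presentation
`K|_Γ = Σ_{A ∈ 𝒦} 𝓛^A` there. The C-I assembly holds the letters as AMBIENT divisors (members of the state and host components) whose
TRACES on `Γ` are the letters, and the presentation as `K|_Γ = (Σ 𝒦)|_Γ` for exponent families `𝒦` on the ambient list. This file is
the translation:

* `MonomialCleanup.gameInv_initialState_of_pointedDistinct`, `carrierGameLift_of_pointedDistinct` — part 4 with `𝓛.Nodup` relaxed to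
  the dictionary's own invariant `PointedDistinct 𝓛` (a letter occurring at two positions has empty support; traces of distinct ambient
  divisors may coincide as EMPTY ideal sheaves of `Γ`, so `Nodup` does not transport but `PointedDistinct` does).
* `comap_monomialSum_map`, `boundaryOf_map_comap` — restriction of a monomial sum = monomial sum of the restricted letters, same exponents.
* `eq_of_stalkIdeal_comap_subschemeι_eq` — for `V(G) + 𝓛` snc: two members of `𝓛` other than `G` whose traces have the same stalk at a
  common point of `Γ` are equal (read in one regular system of parameters: `rsop_index_eq_of_sup_eq`);
  `MonomialCleanup.pointedDistinct_map_comap_subschemeι` — hence pointed-distinctness transports to the traces.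
* **`carrierGameLift_of_ambientLetters`** — `X` regular locally Noetherian, `G ≤ K`, `V(G)` a regular hypersurface (order-one stalk
  generators), ambient letters `𝓛` with `HasSNC (G :: 𝓛)`, `G ∉ 𝓛`, `PointedDistinct 𝓛` (e.g. `𝓛.Nodup`), families `𝒦 ≠ []` on `𝓛` with
  `K|_Γ = (Σ 𝒦)|_Γ` ⟹ a multiple blow-up with regular centres over `cosupp K`, regular top, `K𝒪_top` effective Cartier;
  + the two END-GLUE plugs `MultiHostState.phaseCOne_conclusion_of_ambientLetters` / `…_of_local_ambientLetters`.

AI-written; AI review is weaker than expert review.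

## References (for the mathematics; nothing here is a statement of the manuscript under review)
* J. Kollár, *Lectures on Resolution of Singularities* (2007), Cor. 3.85 («`E|_H`»), (3.111) Step 3. [Kollar2007]
* E. Bierstone, D. Grigoriev, P. Milman, J. Włodarczyk, arXiv:1206.3090, Lemma 3.9.4 (1). [BierstoneGrigorievMilmanWlodarczyk2011]
-/

-- `Summit.<Summit>.<Sub>.Theorems` with `Sub = Summit` (single-conjunct summit, D-0017)
set_option linter.dupNamespace false

noncomputable section

open CategoryTheory AlgebraicGeometry TopologicalSpace IsLocalRing
open Literature.AlgebraicGeometry.Resolution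

namespace Summit.ResolutionOfSingularities.ResolutionOfSingularities.Theorems

universe u

/-! ## §1 The dictionary's initial invariant over a pointed-distinct boundary -/

namespace MonomialCleanup

open PolyhedraGame (State)

variable {X : Scheme.{u}}

/-- **The invariant holds initially** for an snc boundary which is POINTED-DISTINCT (the tree's `gameInv_initialState` with `Nodup`
relaxed to the invariant's own field `pd`). [folklore] -/
theorem gameInv_initialState_of_pointedDistinct {Es : List X.IdealSheafData} (hEs : HasSNC Es) (hpd : PointedDistinct Es)
    {𝒦 : List (List (X.IdealSheafData × ℕ))} (hb : ∀ A ∈ 𝒦, boundaryOf A = Es) :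
    GameInv (initialState Es.length 𝒦) Es 𝒦 id := by
  classical
  have hagree : ∀ A ∈ 𝒦, Agree Es id A (toVec Es.length A) := fun A _ k hk _ => by
    rw [id, toVec_apply, if_pos hk]
  refine
    { snc := hEs, bd := hb, pd := hpd, lab_inj := fun k k' _ _ h => h,
      B_eq := ?_, str_B := fun T hT => Finset.mem_powerset.mp hT, supp := ?_, str := ?_, fwd := ?_, bwd := ?_ }
  · show Finset.range Es.length = _
    rw [Finset.image_id]
  · intro α hα b hb
    show b ∈ Finset.range Es.length
    obtain ⟨A, -, rfl⟩ := List.mem_map.mp (List.mem_toFinset.mp hα)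
    rw [toVec_apply] at hb
    by_cases h : b < Es.length
    · exact Finset.mem_range.mpr h
    · rw [if_neg h] at hb; exact absurd rfl hb
  · intro S hS _
    show S.image id ∈ (Finset.range Es.length).powerset
    rw [Finset.image_id]
    exact Finset.mem_powerset.mpr fun k hk => Finset.mem_range.mpr (hS k hk)
  · intro A hA
    exact ⟨toVec Es.length A, List.mem_toFinset.mpr (List.mem_map.mpr ⟨A, hA, rfl⟩), hagree A hA⟩
  · intro α hα
    obtain ⟨A, hA, rfl⟩ := List.mem_map.mp (List.mem_toFinset.mp hα)
    exact ⟨A, hA, hagree A hA⟩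

/-! ## §2 Traces of an snc family on one of its members -/

/-- **Two members of `𝓛`, other than `H`, of the simple normal crossings family `V(H) + 𝓛` whose TRACES on `V(H)` have the same stalk at
a common point are equal** (both stalks read, modulo the equation of `H`, members of one regular system of parameters;
`rsop_index_eq_of_sup_eq`). [cite: BierstoneGrigorievMilmanWlodarczyk2011, Lemma 3.9.4 (1)] -/
theorem eq_of_stalkIdeal_comap_subschemeι_eq {H : X.IdealSheafData} {BX : List X.IdealSheafData} (hsnc : HasSNC (H :: BX))
    {D₁ D₂ : X.IdealSheafData} (hD₁ : D₁ ∈ BX) (hD₂ : D₂ ∈ BX) (hD₁H : D₁ ≠ H) (s : H.subscheme)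
    (hs₁ : s ∈ (D₁.comap H.subschemeι).support) (hs₂ : s ∈ (D₂.comap H.subschemeι).support)
    (heq : stalkIdeal (D₁.comap H.subschemeι) s = stalkIdeal (D₂.comap H.subschemeι) s) : D₁ = D₂ := by
  have hx₁ : H.subschemeι s ∈ D₁.support := by
    change s ∈ ((D₁.comap H.subschemeι).support : Set _) at hs₁
    rw [Scheme.IdealSheafData.support_comap] at hs₁; exact hs₁
  have hx₂ : H.subschemeι s ∈ D₂.support := by
    change s ∈ ((D₂.comap H.subschemeι).support : Set _) at hs₂
    rw [Scheme.IdealSheafData.support_comap] at hs₂; exact hs₂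
  have hxH := subschemeι_apply_mem_support H s
  -- read everything in a regular system of parameters at `x = ι s`
  obtain ⟨hreg, u, hu, ⟨ι, hιinj, hιu⟩, -⟩ := hsnc (H.subschemeι s)
  haveI := hreg
  generalize hd : (maximalIdeal (X.presheaf.stalk (H.subschemeι s))).spanFinrank = d at u ι hu hιinj hιu
  set q := (H.subschemeι.stalkMap s).hom with hqdef
  have hq : Function.Surjective q := H.subschemeι.stalkMap_surjective s
  have hkerq : RingHom.ker q = stalkIdeal H (H.subschemeι s) := ker_stalkMap_subschemeι H s
  -- `D₁_x + H_x = D₂_x + H_x`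
  have hsup : stalkIdeal D₁ (H.subschemeι s) ⊔ stalkIdeal H (H.subschemeι s) =
      stalkIdeal D₂ (H.subschemeι s) ⊔ stalkIdeal H (H.subschemeι s) := by
    rw [stalkIdeal_comap_eq_map_stalkMap, stalkIdeal_comap_eq_map_stalkMap] at heq
    have h := congrArg (Ideal.comap q) heq
    rwa [Ideal.comap_map_of_surjective q hq, Ideal.comap_map_of_surjective q hq,
      ← RingHom.ker_eq_comap_bot, hkerq] at h
  let A₁ : {D // D ∈ H :: BX ∧ H.subschemeι s ∈ D.support} := ⟨D₁, List.mem_cons_of_mem _ hD₁, hx₁⟩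
  let A₂ : {D // D ∈ H :: BX ∧ H.subschemeι s ∈ D.support} := ⟨D₂, List.mem_cons_of_mem _ hD₂, hx₂⟩
  let AH : {D // D ∈ H :: BX ∧ H.subschemeι s ∈ D.support} := ⟨H, List.mem_cons_self, hxH⟩
  have h1c : ι A₁ ≠ ι AH := fun h => hD₁H (congrArg Subtype.val (hιinj h))
  rw [hιu A₁, hιu A₂, hιu AH] at hsup
  have hab := rsop_index_eq_of_sup_eq hd u hu h1c hsup
  exact congrArg Subtype.val (hιinj hab)

/-- **Pointed-distinctness transports to the traces**: for `V(G) + 𝓛` snc with `G ∉ 𝓛` and `𝓛` pointed-distinct, the list of traces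
`𝓛|_{V(G)}` is pointed-distinct. [folklore] -/
theorem pointedDistinct_map_comap_subschemeι {G : X.IdealSheafData} {𝓛 : List X.IdealSheafData} (hsnc : HasSNC (G :: 𝓛))
    (hG : G ∉ 𝓛) (hpd : PointedDistinct 𝓛) : PointedDistinct (𝓛.map fun D => D.comap G.subschemeι) := by
  intro k k' hk hk' hne s hs hs' heq
  rw [List.length_map] at hk hk'
  rw [nthSheaf_map 𝓛 _ hk] at hs heq
  rw [nthSheaf_map 𝓛 _ hk'] at hs' heq
  have hD₁ : nthSheaf 𝓛 k ∈ 𝓛 := nthSheaf_mem hk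
  have hD₂ : nthSheaf 𝓛 k' ∈ 𝓛 := nthSheaf_mem hk'
  have hD₁G : nthSheaf 𝓛 k ≠ G := fun h => hG (h ▸ hD₁)
  have hEq : nthSheaf 𝓛 k = nthSheaf 𝓛 k' :=
    eq_of_stalkIdeal_comap_subschemeι_eq hsnc hD₁ hD₂ hD₁G s hs hs' (by rw [heq])
  have hx : G.subschemeι s ∈ (nthSheaf 𝓛 k).support := by
    change s ∈ (((nthSheaf 𝓛 k).comap G.subschemeι).support : Set _) at hs
    rw [Scheme.IdealSheafData.support_comap] at hs; exact hs
  have hx' : G.subschemeι s ∈ (nthSheaf 𝓛 k').support := by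
    change s ∈ (((nthSheaf 𝓛 k').comap G.subschemeι).support : Set _) at hs'
    rw [Scheme.IdealSheafData.support_comap] at hs'; exact hs'
  exact hpd k k' hk hk' hne (G.subschemeι s) hx hx' hEq

end MonomialCleanup

/-! ## §3 Restricting monomial sums -/

namespace DepthMultiHost

open DepthTargets (monomialSum monomialSum_nil monomialSum_cons)
open MonomialCleanup (initialState initialState_wf gameInv_initialState_of_pointedDistinct
  exists_isAdmissibleFor_of_winnablePos_one PointedDistinct pointedDistinct_map_comap_subschemeι)
open PolyhedraGame (WinnablePos routeKTarget winnablePos_of_routeKTarget)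

variable {X Y : Scheme.{u}}

/-- Restricting the letters keeps the boundary list in step: `boundaryOf (A|_f) = (boundaryOf A)|_f`. [folklore] -/
theorem boundaryOf_map_comap (f : X ⟶ Y) (A : List (Y.IdealSheafData × ℕ)) :
    boundaryOf (A.map fun p => (p.1.comap f, p.2)) = (boundaryOf A).map fun D => D.comap f := by
  simp [boundaryOf, List.map_map, Function.comp_def]

/-- **Pulling back a monomial SUM: pull back the letters, keep the exponents.** [folklore] -/
theorem comap_monomialSum_map (f : X ⟶ Y) (𝒦 : List (List (Y.IdealSheafData × ℕ))) :
    (monomialSum 𝒦).comap f = monomialSum (𝒦.map fun A => A.map fun p => (p.1.comap f, p.2)) := by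
  induction 𝒦 with
  | nil => rw [List.map_nil, monomialSum_nil, monomialSum_nil, Scheme.IdealSheafData.comap_bot]
  | cons A 𝒦 ih =>
    rw [List.map_cons, monomialSum_cons, monomialSum_cons, Scheme.IdealSheafData.comap_sup,
      MultiHostState.comap_monomialIdeal_map, ih]

/-! ## §4 The carrier game over pointed-distinct letters, and with ambient letters -/

/-- [OURS · L1 W5.2] **CE1 over POINTED-DISTINCT letters** (`carrierGameLift`, part 4, with `𝓛.Nodup` relaxed to `PointedDistinct 𝓛`).
[cite: Kollar2007, Cor. 3.85, (3.111) Step 3] [cite: BierstoneGrigorievMilmanWlodarczyk2011, Lemma 3.9.4] -/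
theorem carrierGameLift_of_pointedDistinct {X : Scheme.{u}} [IsLocallyNoetherian X] (hX : Scheme.IsRegular X)
    {K G : X.IdealSheafData} (hGK : G ≤ K)
    (hGhyp : ∀ x ∈ G.support, ∃ v : X.presheaf.stalk x,
      stalkIdeal G x = Ideal.span {v} ∧ v ∉ (maximalIdeal (X.presheaf.stalk x)) ^ 2)
    (𝓛 : List G.subscheme.IdealSheafData) (h𝓛 : HasSNC 𝓛) (h𝓛pd : PointedDistinct 𝓛)
    (𝒦 : List (List (G.subscheme.IdealSheafData × ℕ))) (hbd : ∀ A ∈ 𝒦, boundaryOf A = 𝓛) (h𝒦 : 𝒦 ≠ [])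
    (hJ : K.comap G.subschemeι = monomialSum 𝒦) :
    ∃ t : CentreSeq X, t.AllRegular ∧ t.CentresOver (K.support : Set X) ∧ Scheme.IsRegular t.top ∧
      IsEffectiveCartier (K.comap t.comp) := by
  classical
  haveI : IsLocallyNoetherian G.subscheme := LocallyOfFiniteType.isLocallyNoetherian G.subschemeι
  have hw : WinnablePos 1 (initialState 𝓛.length 𝒦) :=
    winnablePos_of_routeKTarget (routeKTarget le_rfl) _ (initialState_wf 𝓛.length h𝒦) 𝓛.length rfl
  obtain ⟨t, hadm, -, htop⟩ := exists_isAdmissibleFor_of_winnablePos_one hw G.subscheme 𝓛 𝒦 id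
    (gameInv_initialState_of_pointedDistinct h𝓛 h𝓛pd hbd)
  have hker : G.subschemeι.ker = G := Scheme.IdealSheafData.ker_subschemeι G
  have hH : ∀ x ∈ G.subschemeι.ker.support, ∃ v : X.presheaf.stalk x,
      stalkIdeal G.subschemeι.ker x = Ideal.span {v} ∧ v ∉ (maximalIdeal (X.presheaf.stalk x)) ^ 2 := by
    rw [hker]; exact hGhyp
  have hB : ∃ BS' : List G.subscheme.IdealSheafData,
      BS'.Sublist (⟨monomialSum 𝒦, 𝓛, 1⟩ : MarkedIdeal G.subscheme).boundary ∧
        BoundaryRel G.subschemeι (⟨K, [], 1⟩ : MarkedIdeal X).boundary BS' :=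
    ⟨[], List.nil_sublist _, boundaryRel_subschemeι G [] (hasSNC_singleton_of_generator hX hGhyp)⟩
  obtain ⟨hadmX, hregX, htopX⟩ := CarrierGoingUp.isAdmissibleFor_pushforward_and_ideal_eq_top t G.subschemeι
    ⟨K, [], 1⟩ ⟨monomialSum 𝒦, 𝓛, 1⟩ hX hH hJ.symm rfl rfl hB (by rw [hker]; exact hGK) hadm htop
  obtain ⟨E, hE, hEq⟩ := CarrierGoingUp.exists_isEffectiveCartier_mul_transformMarked_ideal
    (t.pushforward G.subschemeι) ⟨K, [], 1⟩ hadmX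
  refine ⟨t.pushforward G.subschemeι, CentreSeq.IsAdmissibleFor.allRegular _ _ hadmX,
    CentreSeq.IsAdmissibleFor.centresOver _ _ hadmX le_rfl, hregX, ?_⟩
  have hKE : K.comap (t.pushforward G.subschemeι).comp = E := by
    rw [htopX, ← Scheme.IdealSheafData.one_eq_top, mul_one] at hEq
    exact hEq
  rw [hKE]
  exact hE

/-- [OURS · L1 W5.2] **CE1 WITH AMBIENT LETTERS.** `X` regular locally Noetherian (e.g. an open patch), `G ≤ K`, `V(G)` a regular
hypersurface (order-one stalk generators), ambient letters `𝓛` — ideal sheaves of `X` with `V(G) + 𝓛` a simple normal crossings family,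
`G ∉ 𝓛`, pointed-distinct (e.g. `𝓛.Nodup`, `PointedDistinct.of_nodup`) —, exponent families `𝒦 ≠ []` on `𝓛` with `K|_{V(G)} = (Σ 𝒦)|_{V(G)}`:
then some multiple blow-up of `X` with regular centres over `cosupp K` and regular top makes `K𝒪_top` an effective Cartier divisor.
(The game runs on the traces: `hasSNC_filter_map_comap_subschemeι`, `pointedDistinct_map_comap_subschemeι`, `comap_monomialSum_map`.)
[cite: Kollar2007, Cor. 3.85, (3.111) Step 3] [cite: BierstoneGrigorievMilmanWlodarczyk2011, Lemma 3.9.4 (1)] -/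
theorem carrierGameLift_of_ambientLetters {X : Scheme.{u}} [IsLocallyNoetherian X] (hX : Scheme.IsRegular X)
    {K G : X.IdealSheafData} (hGK : G ≤ K)
    (hGhyp : ∀ x ∈ G.support, ∃ v : X.presheaf.stalk x,
      stalkIdeal G x = Ideal.span {v} ∧ v ∉ (maximalIdeal (X.presheaf.stalk x)) ^ 2)
    (𝓛 : List X.IdealSheafData) (hsnc : HasSNC (G :: 𝓛)) (hG𝓛 : G ∉ 𝓛) (hpd : PointedDistinct 𝓛)
    (𝒦 : List (List (X.IdealSheafData × ℕ))) (hbd : ∀ A ∈ 𝒦, boundaryOf A = 𝓛) (h𝒦 : 𝒦 ≠ [])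
    (hJ : K.comap G.subschemeι = (monomialSum 𝒦).comap G.subschemeι) :
    ∃ t : CentreSeq X, t.AllRegular ∧ t.CentresOver (K.support : Set X) ∧ Scheme.IsRegular t.top ∧
      IsEffectiveCartier (K.comap t.comp) := by
  classical
  have hfilter : (𝓛.filter fun D => D ≠ G) = 𝓛 :=
    List.filter_eq_self.mpr fun D hD => by simpa using ne_of_mem_of_not_mem hD hG𝓛
  have hsncΓ : HasSNC (𝓛.map fun D => D.comap G.subschemeι) := by
    have h := hasSNC_filter_map_comap_subschemeι G 𝓛 hsnc
    rwa [hfilter] at h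
  refine carrierGameLift_of_pointedDistinct hX hGK hGhyp (𝓛.map fun D => D.comap G.subschemeι) hsncΓ
    (pointedDistinct_map_comap_subschemeι hsnc hG𝓛 hpd)
    (𝒦.map fun A => A.map fun p => (p.1.comap G.subschemeι, p.2)) (fun A' hA' => ?_) (by simpa using h𝒦)
    (hJ.trans (comap_monomialSum_map G.subschemeι 𝒦))
  obtain ⟨A, hA, rfl⟩ := List.mem_map.mp hA'
  rw [boundaryOf_map_comap, hbd A hA]

/-- [OURS · L1 W5.2] **CE1 WITH AMBIENT LETTERS ⇒ THE `PhaseCOne` CONCLUSION (global carrier)** — into res-L1-w52-lead-1's END GLUE.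
[cite: Kollar2007, (3.111) Step 3] -/
theorem MultiHostState.phaseCOne_conclusion_of_ambientLetters {X : Scheme.{u}} [IsNoetherian X] (hX : Scheme.IsRegular X)
    (S₁ : MultiHostState X) (hn : S₁.n ≠ 0) {G : X.IdealSheafData} (hGK : G ≤ S₁.residual.K)
    (hGhyp : ∀ x ∈ G.support, ∃ v : X.presheaf.stalk x,
      stalkIdeal G x = Ideal.span {v} ∧ v ∉ (maximalIdeal (X.presheaf.stalk x)) ^ 2)
    (𝓛 : List X.IdealSheafData) (hsnc : HasSNC (G :: 𝓛)) (hG𝓛 : G ∉ 𝓛) (hpd : PointedDistinct 𝓛)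
    (𝒦 : List (List (X.IdealSheafData × ℕ))) (hbd : ∀ A ∈ 𝒦, boundaryOf A = 𝓛) (h𝒦 : 𝒦 ≠ [])
    (hJ : S₁.residual.K.comap G.subschemeι = (monomialSum 𝒦).comap G.subschemeι) :
    ∃ (s : CentreSeq X), s.AllRegular ∧ s.CentresOver (S₁.K.support : Set X) ∧ Scheme.IsRegular s.top ∧
      ∃ (_ : IsNoetherian s.top) (M : s.top.IdealSheafData) (S₂ : MultiHostState s.top),
        S₁.K.comap s.comp = M * S₂.K ∧ IsEffectiveCartier M ∧ S₂.n ≠ 0 ∧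
        ∃ (U : s.top.Opens), S₂.residual.IsEndOn U := by
  obtain ⟨t, htreg, htover, httop, hE⟩ := carrierGameLift_of_ambientLetters hX hGK hGhyp 𝓛 hsnc hG𝓛 hpd 𝒦 hbd h𝒦 hJ
  exact S₁.phaseCOne_conclusion_of_isEffectiveCartier hn t htreg htover httop hE

/-- [OURS · L1 W5.2] **CE1 WITH AMBIENT LETTERS ON A PATCH ⇒ THE `PhaseCOne` CONCLUSION** (carrier and letters on an open
`X₀ ⊇ cosupp K♭`, `X` regular Noetherian integral) — into res-L1-w52-lead-1's LOCAL END GLUE. [cite: Kollar2007, (3.111) Step 3]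
[cite: GortzWedhorn2020, Prop. 13.91 (1)–(2)] -/
theorem MultiHostState.phaseCOne_conclusion_of_local_ambientLetters {X X₀ : Scheme.{u}} [IsNoetherian X] [IsIntegral X]
    (hX : Scheme.IsRegular X) (S₁ : MultiHostState X) (hn : S₁.n ≠ 0) (hK0 : S₁.residual.K ≠ ⊥)
    (j : X₀ ⟶ X) [IsOpenImmersion j] (hZj : (S₁.residual.K.support : Set X) ⊆ Set.range j.base)
    {G₀ : X₀.IdealSheafData} (hGK : G₀ ≤ S₁.residual.K.comap j)
    (hGhyp : ∀ x ∈ G₀.support, ∃ v : X₀.presheaf.stalk x,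
      stalkIdeal G₀ x = Ideal.span {v} ∧ v ∉ (maximalIdeal (X₀.presheaf.stalk x)) ^ 2)
    (𝓛 : List X₀.IdealSheafData) (hsnc : HasSNC (G₀ :: 𝓛)) (hG𝓛 : G₀ ∉ 𝓛) (hpd : PointedDistinct 𝓛)
    (𝒦 : List (List (X₀.IdealSheafData × ℕ))) (hbd : ∀ A ∈ 𝒦, boundaryOf A = 𝓛) (h𝒦 : 𝒦 ≠ [])
    (hJ : (S₁.residual.K.comap j).comap G₀.subschemeι = (monomialSum 𝒦).comap G₀.subschemeι) :
    ∃ (s : CentreSeq X), s.AllRegular ∧ s.CentresOver (S₁.K.support : Set X) ∧ Scheme.IsRegular s.top ∧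
      ∃ (_ : IsNoetherian s.top) (M : s.top.IdealSheafData) (S₂ : MultiHostState s.top),
        S₁.K.comap s.comp = M * S₂.K ∧ IsEffectiveCartier M ∧ S₂.n ≠ 0 ∧
        ∃ (U : s.top.Opens), S₂.residual.IsEndOn U := by
  haveI : IsLocallyNoetherian X₀ := LocallyOfFiniteType.isLocallyNoetherian j
  have hX₀ : Scheme.IsRegular X₀ := Scheme.IsRegular.of_isOpenImmersion j hX
  obtain ⟨t₀, h₀reg, h₀over, -, hE⟩ :=
    carrierGameLift_of_ambientLetters hX₀ hGK hGhyp 𝓛 hsnc hG𝓛 hpd 𝒦 hbd h𝒦 hJ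
  refine S₁.phaseCOne_conclusion_of_local hX hn hK0 j hZj t₀ h₀reg ?_ hE.isLocallyPrincipal
  rw [Scheme.IdealSheafData.support_comap] at h₀over
  exact h₀over

end DepthMultiHost

end Summit.ResolutionOfSingularities.ResolutionOfSingularities.Theorems

end
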